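import Mathlib
import Summits.RiemannHypothesis.RiemannHypothesis.Theorems.WeilFarFloorSecondOrderLawRH
import Summits.RiemannHypothesis.RiemannHypothesis.Theorems.WeilFarFloorSecondOrderLowerRH
import Summits.RiemannHypothesis.RiemannHypothesis.Theorems.WeilFarFloorCoshQuotientContinuity
import HarnessLib

/-!
# The second-order law of the floor gap, both halves: `λ_max(a) = R_c(a) + (1 + o(1))·J(a)/R_c(a) + o(e^{−a})` (under RH)

Helper file (`--supports stmt-RiemannHypothesis-0098`, lead-track anchor: Weil-positivity window ladder, format-C far bound),
pure proofs.  Seat rh-explicit-weil-1 gen15 (memo `run/shared/lean/pub/rh-explicit/rh-explicit-weil-1/FORMAT-K3.md` §16.4).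

The upper half `WeilFarFloorSecondOrderLawRH.farCoercivityFloor_le_coshQuotient_add_secondOrder_of_RH` (ns `FloorCoshSplit`) and the
lower half `WeilFarFloorSecondOrderLowerRH.farCoercivityFloor_ge_coshQuotient_add_secondOrder_of_RH` (ns `FloorSecondOrder`) together:

★ `farCoercivityFloor_secondOrder_twoSided_of_RH`: under RH, for every `ε > 0`, eventually in `a`,
`R_c(a) + (1 − ε)J(a)/R_c(a) − εe^{−a} ≤ λ_max(a) ≤ R_c(a) + (1 + ε)J(a)/R_c(a) + εe^{−a}`;
★ `abs_farCoercivityFloor_sub_coshQuotient_sub_secondOrder_le_of_RH`: `|λ_max(a) − R_c(a) − J(a)/R_c(a)| ≤ ε·(J(a)/R_c(a) + e^{−a})`;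
★ `tendsto_secondOrder_relativeError_of_RH`: `(λ_max(a) − R_c(a) − J(a)/R_c(a))/(J(a)/R_c(a) + e^{−a}) → 0`.
Here `R_c(a) = Q_a(C_a)/(a + sinh a)` (`C_a = 1_{[−a,a]}cosh(·/2)`) and `J(a) = ∫_{(−a,a)}(T_aC_a − R_c(a)C_a)²/(a + sinh a)` is the
residual energy of the cosh profile under the prime-shift operator — an explicit finite prime sum: the COEFFICIENT of the floor gap.
Standard axioms only.
-/

set_option linter.dupNamespace false
set_option autoImplicit false

noncomputable section

open MeasureTheory Set Filter
open scoped Real Topology ArithmeticFunction.vonMangoldt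

namespace Summit.RiemannHypothesis.RiemannHypothesis.Theorems.WeilFormatC

namespace FloorSecondOrder

open Literature.NumberTheory.LFunctions FloorCosh FloorCoshSplit

/-- ★ **THE SECOND-ORDER LAW OF THE FLOOR GAP (both halves, under RH).**  For every `ε > 0`, eventually in `a`:
`R_c(a) + (1 − ε)·J(a)/R_c(a) − ε·e^{−a} ≤ λ_max(a) ≤ R_c(a) + (1 + ε)·J(a)/R_c(a) + ε·e^{−a}`. -/
theorem farCoercivityFloor_secondOrder_twoSided_of_RH (hRH : RiemannHypothesis) {ε : ℝ} (hε : 0 < ε) :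
    ∃ a₀ : ℝ, ∀ a : ℝ, a₀ ≤ a →
      primeShiftForm a ((Icc (-a) a).indicator (fun y ↦ Real.cosh (y / 2))) / (a + Real.sinh a)
          + (1 - ε)
            * ((∫ x in Ioo (-a) a,
                ((∑ n ∈ weilPrimeIndex a, (Λ n : ℝ) / Real.sqrt n *
                    ((Icc (-a) a).indicator (fun y ↦ Real.cosh (y / 2)) (x - Real.log n)
                      + (Icc (-a) a).indicator (fun y ↦ Real.cosh (y / 2)) (x + Real.log n)))
                  - primeShiftForm a ((Icc (-a) a).indicator (fun y ↦ Real.cosh (y / 2))) / (a + Real.sinh a)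
                    * (Icc (-a) a).indicator (fun y ↦ Real.cosh (y / 2)) x) ^ 2) / (a + Real.sinh a))
            / (primeShiftForm a ((Icc (-a) a).indicator (fun y ↦ Real.cosh (y / 2))) / (a + Real.sinh a))
          - ε * Real.exp (-a)
        ≤ farCoercivityFloor a ∧
      farCoercivityFloor a
        ≤ primeShiftForm a ((Icc (-a) a).indicator (fun y ↦ Real.cosh (y / 2))) / (a + Real.sinh a)
          + (1 + ε)
            * ((∫ x in Ioo (-a) a,
                ((∑ n ∈ weilPrimeIndex a, (Λ n : ℝ) / Real.sqrt n *
                    ((Icc (-a) a).indicator (fun y ↦ Real.cosh (y / 2)) (x - Real.log n)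
                      + (Icc (-a) a).indicator (fun y ↦ Real.cosh (y / 2)) (x + Real.log n)))
                  - primeShiftForm a ((Icc (-a) a).indicator (fun y ↦ Real.cosh (y / 2))) / (a + Real.sinh a)
                    * (Icc (-a) a).indicator (fun y ↦ Real.cosh (y / 2)) x) ^ 2) / (a + Real.sinh a))
            / (primeShiftForm a ((Icc (-a) a).indicator (fun y ↦ Real.cosh (y / 2))) / (a + Real.sinh a))
          + ε * Real.exp (-a) := by
  obtain ⟨a₁, h₁⟩ := farCoercivityFloor_ge_coshQuotient_add_secondOrder_of_RH hRH hε
  obtain ⟨a₂, h₂⟩ := farCoercivityFloor_le_coshQuotient_add_secondOrder_of_RH hRH hε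
  exact ⟨max a₁ a₂, fun a ha ↦ ⟨h₁ a (le_trans (le_max_left _ _) ha), h₂ a (le_trans (le_max_right _ _) ha)⟩⟩

/-- ★ **The coefficient of the gap is the residual energy**: under RH, for every `ε > 0`, eventually in `a`,
`|λ_max(a) − R_c(a) − J(a)/R_c(a)| ≤ ε·(J(a)/R_c(a) + e^{−a})`. -/
theorem abs_farCoercivityFloor_sub_coshQuotient_sub_secondOrder_le_of_RH (hRH : RiemannHypothesis) {ε : ℝ} (hε : 0 < ε) :
    ∃ a₀ : ℝ, ∀ a : ℝ, a₀ ≤ a →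
      |farCoercivityFloor a
          - primeShiftForm a ((Icc (-a) a).indicator (fun y ↦ Real.cosh (y / 2))) / (a + Real.sinh a)
          - ((∫ x in Ioo (-a) a,
                ((∑ n ∈ weilPrimeIndex a, (Λ n : ℝ) / Real.sqrt n *
                    ((Icc (-a) a).indicator (fun y ↦ Real.cosh (y / 2)) (x - Real.log n)
                      + (Icc (-a) a).indicator (fun y ↦ Real.cosh (y / 2)) (x + Real.log n)))
                  - primeShiftForm a ((Icc (-a) a).indicator (fun y ↦ Real.cosh (y / 2))) / (a + Real.sinh a)
                    * (Icc (-a) a).indicator (fun y ↦ Real.cosh (y / 2)) x) ^ 2) / (a + Real.sinh a))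
            / (primeShiftForm a ((Icc (-a) a).indicator (fun y ↦ Real.cosh (y / 2))) / (a + Real.sinh a))|
        ≤ ε * (((∫ x in Ioo (-a) a,
                ((∑ n ∈ weilPrimeIndex a, (Λ n : ℝ) / Real.sqrt n *
                    ((Icc (-a) a).indicator (fun y ↦ Real.cosh (y / 2)) (x - Real.log n)
                      + (Icc (-a) a).indicator (fun y ↦ Real.cosh (y / 2)) (x + Real.log n)))
                  - primeShiftForm a ((Icc (-a) a).indicator (fun y ↦ Real.cosh (y / 2))) / (a + Real.sinh a)
                    * (Icc (-a) a).indicator (fun y ↦ Real.cosh (y / 2)) x) ^ 2) / (a + Real.sinh a))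
            / (primeShiftForm a ((Icc (-a) a).indicator (fun y ↦ Real.cosh (y / 2))) / (a + Real.sinh a))
          + Real.exp (-a)) := by
  obtain ⟨a₀, h⟩ := farCoercivityFloor_secondOrder_twoSided_of_RH hRH hε
  refine ⟨a₀, fun a ha ↦ ?_⟩
  obtain ⟨hlo, hhi⟩ := h a ha
  set Rc := primeShiftForm a ((Icc (-a) a).indicator (fun y ↦ Real.cosh (y / 2))) / (a + Real.sinh a) with hRc
  set J := (∫ x in Ioo (-a) a,
      ((∑ n ∈ weilPrimeIndex a, (Λ n : ℝ) / Real.sqrt n *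
          ((Icc (-a) a).indicator (fun y ↦ Real.cosh (y / 2)) (x - Real.log n)
            + (Icc (-a) a).indicator (fun y ↦ Real.cosh (y / 2)) (x + Real.log n)))
        - Rc * (Icc (-a) a).indicator (fun y ↦ Real.cosh (y / 2)) x) ^ 2) / (a + Real.sinh a) with hJ
  have e1 : (1 - ε) * J / Rc = J / Rc - ε * (J / Rc) := by ring
  have e2 : (1 + ε) * J / Rc = J / Rc + ε * (J / Rc) := by ring
  rw [abs_le]
  constructor <;> linarith only [hlo, hhi, e1, e2]

/-- ★ **The second-order law as a limit**: under RH, `(λ_max(a) − R_c(a) − J(a)/R_c(a)) / (J(a)/R_c(a) + e^{−a}) → 0` as `a → ∞`. -/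
theorem tendsto_secondOrder_relativeError_of_RH (hRH : RiemannHypothesis) :
    Tendsto (fun a : ℝ ↦
      (farCoercivityFloor a
          - primeShiftForm a ((Icc (-a) a).indicator (fun y ↦ Real.cosh (y / 2))) / (a + Real.sinh a)
          - ((∫ x in Ioo (-a) a,
                ((∑ n ∈ weilPrimeIndex a, (Λ n : ℝ) / Real.sqrt n *
                    ((Icc (-a) a).indicator (fun y ↦ Real.cosh (y / 2)) (x - Real.log n)
                      + (Icc (-a) a).indicator (fun y ↦ Real.cosh (y / 2)) (x + Real.log n)))
                  - primeShiftForm a ((Icc (-a) a).indicator (fun y ↦ Real.cosh (y / 2))) / (a + Real.sinh a)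
                    * (Icc (-a) a).indicator (fun y ↦ Real.cosh (y / 2)) x) ^ 2) / (a + Real.sinh a))
            / (primeShiftForm a ((Icc (-a) a).indicator (fun y ↦ Real.cosh (y / 2))) / (a + Real.sinh a)))
        / (((∫ x in Ioo (-a) a,
                ((∑ n ∈ weilPrimeIndex a, (Λ n : ℝ) / Real.sqrt n *
                    ((Icc (-a) a).indicator (fun y ↦ Real.cosh (y / 2)) (x - Real.log n)
                      + (Icc (-a) a).indicator (fun y ↦ Real.cosh (y / 2)) (x + Real.log n)))
                  - primeShiftForm a ((Icc (-a) a).indicator (fun y ↦ Real.cosh (y / 2))) / (a + Real.sinh a)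
                    * (Icc (-a) a).indicator (fun y ↦ Real.cosh (y / 2)) x) ^ 2) / (a + Real.sinh a))
            / (primeShiftForm a ((Icc (-a) a).indicator (fun y ↦ Real.cosh (y / 2))) / (a + Real.sinh a))
          + Real.exp (-a))) atTop (𝓝 0) := by
  rw [Metric.tendsto_nhds]
  intro ε hε
  obtain ⟨a₀, h⟩ := abs_farCoercivityFloor_sub_coshQuotient_sub_secondOrder_le_of_RH hRH (half_pos hε)
  filter_upwards [eventually_ge_atTop (max a₀ 0)] with a ha
  have ha0 : 0 ≤ a := le_trans (le_max_right _ _) ha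
  have hb := h a (le_trans (le_max_left _ _) ha)
  set Rc := primeShiftForm a ((Icc (-a) a).indicator (fun y ↦ Real.cosh (y / 2))) / (a + Real.sinh a) with hRc
  set J := (∫ x in Ioo (-a) a,
      ((∑ n ∈ weilPrimeIndex a, (Λ n : ℝ) / Real.sqrt n *
          ((Icc (-a) a).indicator (fun y ↦ Real.cosh (y / 2)) (x - Real.log n)
            + (Icc (-a) a).indicator (fun y ↦ Real.cosh (y / 2)) (x + Real.log n)))
        - Rc * (Icc (-a) a).indicator (fun y ↦ Real.cosh (y / 2)) x) ^ 2) / (a + Real.sinh a) with hJ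
  -- `R_c(a) ≥ 0` (the cosh quotient grows from `Q_0 = 0`) and `J ≥ 0`, so the denominator is `≥ e^{−a} > 0`
  have hP0 : 0 ≤ a + Real.sinh a := by have := Real.sinh_nonneg_iff.2 ha0; linarith only [this, ha0]
  have hRc0 : 0 ≤ Rc := by
    obtain ⟨hQ0, -⟩ := primeShiftForm_coshTest_sub_nonneg_le (a := 0) (a' := a) le_rfl ha0
    have hz : primeShiftForm 0 ((Icc (-(0 : ℝ)) 0).indicator (fun y ↦ Real.cosh (y / 2))) = 0 := by
      rw [primeShiftForm_coshTest]; simp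
    rw [hRc]; exact div_nonneg (by linarith only [hQ0, hz]) hP0
  have hJ0 : 0 ≤ J := by
    rw [hJ]; exact div_nonneg (setIntegral_nonneg measurableSet_Ioo fun x _ ↦ sq_nonneg _) hP0
  have hden : 0 < J / Rc + Real.exp (-a) := by
    have h1 := div_nonneg hJ0 hRc0
    have h2 := Real.exp_pos (-a)
    linarith only [h1, h2]
  rw [Real.dist_eq, sub_zero, abs_div, abs_of_pos hden, div_lt_iff₀ hden]
  have h3 := mul_pos hε hden
  linarith only [hb, h3]

end FloorSecondOrder

end Summit.RiemannHypothesis.RiemannHypothesis.Theorems.WeilFormatC
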